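import Summits.KontsevichZagierPeriods.KontsevichZagierPeriods.Theorems.RootDecompRelativeModAbsoluteRegFoldingDegOneP14
import Literature.ModelTheory.ExponentialFields.SemialgebraicC1TriangulationProofs
import Literature.NumberTheory.Transcendental.SemialgebraicMonotonicityProofs

/-!
# NODE g10 — companion file 2: LOG-TAMENESS of integrable one-variable semialgebraic functions (D5/D8 cross terms)

`decomp-kz-lens-3`, generation 10 (planner-decomp-kz-lens-3-g10-0), 2026-08-30.  The lowering of the tame part to
pure-log cells (glue D5, `CylLogSplit.lean` §3aa/§3ab) needs the base bounds `q · log W_i ∈ L¹` for coefficients `q`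
that are `ℚ`-combinations of ALL tame `b_j` and for EVERY index `i` of the cell — i.e. CROSS TERMS `b_j · log W_i`,
not only the diagonal terms `b_i · log W_i` certified by the end-type table of the memo (§B).  In one base variable
(the rung `CylKernelZeroLog` has base `Fin 1 → ℝ`) they are supplied by LOG-TAMENESS:

* `exists_rpow_bound_of_integrableOn`: a `ℚ`-semialgebraic `φ` on `(a, c)` which is integrable there satisfies
  `|φ t| ≤ C (t − a)^{1/N − 1}` on some `(a, a + δ)` (`N ≥ 1`) — PROVED from the tree's MONOTONICITY THEOREM for
  semialgebraic functions (`semialgebraic_monotonicity_holds`, van den Dries 1998 Ch. 3 (1.2)) and the tree's GROWTH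
  DICHOTOMY (`exists_abs_pow_le_mul_of_tendsto`, HaPham2016 Lemma 1.7) applied to `s ↦ s·|φ(a + s)| → 0`;
* `integrableOn_rpow_mul_abs_log`, `integrableOn_mul_of_rpow_bound_of_log_bound`: hence `φ · g ∈ L¹(a, a + δ)` for
  every measurable `g` with `|g| ≤ A + B |log (t − a)|` (all `log W_i`, `W_i` semialgebraic, are such by `OneVarPowerBounds`).
Separate file for the same reason as `OneVarPowerBounds.lean` (the model-theory imports force a cold elaboration).
-/

open Set MeasureTheory Filter Topology
open Literature.NumberTheory.Transcendental Literature.ModelTheory.ExponentialFields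

namespace Summit.KontsevichZagierPeriods.RootDecompRelativeModAbsolute.Rung30571.RegularisedLogLayer.CylLogTame

/-- Translation `a ↦ 0⁺`: the translate `s ↦ φ (s + a)` is real-semialgebraic on `(0, c − a)` (verbatim the lemma of
`OneVarPowerBounds.lean`). -/
private theorem isSemialgebraicFunOn_translate {φ : ℝ → ℝ} {a c : ℝ}
    (hφ : IsSemialgebraicFunOn ℚ {x : Fin 1 → ℝ | x 0 ∈ Set.Ioo a c} (fun x => φ (x 0))) :
    IsSemialgebraicFunOn ℝ {x : Fin 1 → ℝ | x 0 ∈ Ioo 0 (c - a)} (fun x => φ (x 0 + a)) := by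
  have hφR := hφ.real_of
  have hS' : IsSemialgebraic ℝ {x : Fin 1 → ℝ | x 0 ∈ Ioo 0 (c - a)} :=
    SemialgebraicMonotonicity.sa_mem_Ioo 0 0 (c - a)
  have hf : IsSemialgebraicMapOn ℝ {x : Fin 1 → ℝ | x 0 ∈ Ioo 0 (c - a)}
      (fun x (j : Fin 1) => MvPolynomial.aeval x
        ((fun _ => (MvPolynomial.X 0 + MvPolynomial.C a : MvPolynomial (Fin 1) ℝ)) j)) :=
    isSemialgebraicMapOn_aeval hS' _
  have hf' : IsSemialgebraicMapOn ℝ {x : Fin 1 → ℝ | x 0 ∈ Ioo 0 (c - a)}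
      (fun x (_ : Fin 1) => x 0 + a) :=
    hf.congr fun x _ => by
      funext j
      simp
  have hst : MapsTo (fun (x : Fin 1 → ℝ) (_ : Fin 1) => x 0 + a)
      {x : Fin 1 → ℝ | x 0 ∈ Ioo 0 (c - a)} {x : Fin 1 → ℝ | x 0 ∈ Ioo a c} := by
    intro x hx
    simp only [mem_setOf_eq, mem_Ioo] at hx ⊢
    constructor <;> linarith [hx.1, hx.2]
  exact (IsSemialgebraicFunOn.comp_isSemialgebraicMapOn_holds hφR hf' hst).congr fun _ _ => rfl

/-! ## §1 Pure analysis: an antitone nonnegative integrable function satisfies `(t − a)·φ(t) → 0` at `a⁺` -/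

/-- Auxiliary step `tendsto_mul_of_antitoneOn`. [bookkeeping] -/
theorem tendsto_mul_of_antitoneOn {φ : ℝ → ℝ} {a w : ℝ} (haw : a < w) (hanti : AntitoneOn φ (Ioo a w))
    (hpos : ∀ t ∈ Ioo a w, 0 ≤ φ t) (hint : IntegrableOn φ (Ioo a w)) :
    Tendsto (fun t => (t - a) * φ t) (𝓝[>] a) (𝓝 0) := by
  have hII : IntervalIntegrable φ volume a w := by
    rw [intervalIntegrable_iff_integrableOn_Ioo_of_le haw.le]; exact hint
  have hF : ContinuousOn (fun t => ∫ x in a..t, φ x) (uIcc a w) :=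
    intervalIntegral.continuousOn_primitive_interval' hII left_mem_uIcc
  have hFa : Tendsto (fun t => ∫ x in a..t, φ x) (𝓝[>] a) (𝓝 0) := by
    have h' : Tendsto (fun t => ∫ x in a..t, φ x) (𝓝[uIcc a w] a) (𝓝 (∫ x in a..a, φ x)) :=
      (hF a left_mem_uIcc).tendsto
    rw [intervalIntegral.integral_same] at h'
    refine h'.mono_left ?_
    rw [uIcc_of_le haw.le, ← nhdsWithin_Ioo_eq_nhdsGT haw]
    exact nhdsWithin_mono _ Ioo_subset_Icc_self
  have hle : ∀ t ∈ Ioo a w, (t - a) * φ t ≤ ∫ x in a..t, φ x := by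
    intro t ht
    have hint' : IntegrableOn φ (Ioo a t) := hint.mono_set (Ioo_subset_Ioo_right ht.2.le)
    have hconst : IntegrableOn (fun _ => φ t) (Ioo a t) :=
      (continuousOn_const.integrableOn_Icc (a := a) (b := t)).mono_set Ioo_subset_Icc_self
    rw [intervalIntegral.integral_of_le ht.1.le, integral_Ioc_eq_integral_Ioo]
    have h1 : ∫ _ in Ioo a t, φ t = (t - a) * φ t := by
      rw [setIntegral_const, Real.volume_real_Ioo_of_le ht.1.le, smul_eq_mul]
    rw [← h1]
    exact setIntegral_mono_on hconst hint' measurableSet_Ioo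
      fun x hx => hanti ⟨hx.1, hx.2.trans ht.2⟩ ht hx.2.le
  have hge : ∀ t ∈ Ioo a w, 0 ≤ (t - a) * φ t := fun t ht =>
    mul_nonneg (by linarith [ht.1]) (hpos t ht)
  refine tendsto_of_tendsto_of_tendsto_of_le_of_le' tendsto_const_nhds hFa ?_ ?_
  · filter_upwards [Ioo_mem_nhdsGT haw] with t ht using hge t ht
  · filter_upwards [Ioo_mem_nhdsGT haw] with t ht using hle t ht

/-! ## §2 The growth dichotomy applied to `s ↦ s·φ(a+s)`: `(t−a)φ(t) → 0` ⇒ `|φ t| ≤ C (t−a)^{1/N−1}` -/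

/-- Auxiliary step `exists_rpow_bound_of_tendsto`. [bookkeeping] -/
theorem exists_rpow_bound_of_tendsto {φ : ℝ → ℝ} {a c : ℝ} (hac : a < c)
    (hφ : IsSemialgebraicFunOn ℚ {x : Fin 1 → ℝ | x 0 ∈ Ioo a c} (fun x => φ (x 0)))
    (h0 : Tendsto (fun t => (t - a) * φ t) (𝓝[>] a) (𝓝 0)) :
    ∃ (N : ℕ) (C δ : ℝ), 0 < N ∧ 0 < δ ∧
      ∀ t ∈ Ioo a (a + δ), |φ t| ≤ C * (t - a) ^ ((N : ℝ)⁻¹ - 1) := by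
  have hψ := isSemialgebraicFunOn_translate hφ
  have hS' : IsSemialgebraic ℝ {x : Fin 1 → ℝ | x 0 ∈ Ioo 0 (c - a)} :=
    SemialgebraicMonotonicity.sa_mem_Ioo 0 0 (c - a)
  have hX : IsSemialgebraicFunOn ℝ {x : Fin 1 → ℝ | x 0 ∈ Ioo 0 (c - a)} (fun x => x 0) :=
    Literature.NumberTheory.Transcendental.isSemialgebraicFunOn_apply hS' 0
  have hg : IsSemialgebraicFunOn ℝ {x : Fin 1 → ℝ | x 0 ∈ Ioo 0 (c - a)}
      (fun x => x 0 * φ (x 0 + a)) := IsSemialgebraicFunOn.mul_holds hX hψ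
  have hG : IsSemialgebraic ℝ
      {w : Fin 2 → ℝ | w 0 ∈ Ioo 0 (c - a) ∧ w 1 = (fun s => s * φ (s + a)) (w 0)} :=
    isSemialgebraic_graph_of_isSemialgebraicFunOn (S := Ioo 0 (c - a)) (f := fun s => s * φ (s + a)) hg
  have hg0 : Tendsto (fun s => s * φ (s + a)) (𝓝[>] 0) (𝓝 0) := by
    have hsh : Tendsto (fun s : ℝ => s + a) (𝓝[>] 0) (𝓝[>] a) := by
      refine tendsto_nhdsWithin_of_tendsto_nhds_of_eventually_within _ ?_ ?_
      · have hc : Continuous (fun s : ℝ => s + a) := continuous_id.add continuous_const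
        have h := (hc.tendsto (0:ℝ)).mono_left (nhdsWithin_le_nhds (s := Ioi 0))
        simpa using h
      · filter_upwards [self_mem_nhdsWithin] with s hs
        simpa using hs
    refine (h0.comp hsh).congr fun s => ?_
    simp [Function.comp]
  obtain ⟨m, C, δ, hm, hδ, hb⟩ :=
    exists_abs_pow_le_mul_of_tendsto (f := fun s => s * φ (s + a)) (sub_pos.mpr hac) hG hg0
  have hC : 0 ≤ C := by
    have h := hb (δ / 2) ⟨by linarith, by linarith⟩
    have h' : 0 ≤ C * (δ / 2) := le_trans (pow_nonneg (abs_nonneg _) _) h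
    by_contra hneg
    have : C * (δ / 2) < 0 := mul_neg_of_neg_of_pos (lt_of_not_ge hneg) (by linarith)
    linarith
  refine ⟨m, C ^ ((m:ℝ)⁻¹), δ, by omega, hδ, fun t ht => ?_⟩
  have hs0 : 0 < t - a := by linarith [ht.1]
  have hsδ : t - a < δ := by linarith [ht.2]
  have key : |(t - a) * φ t| ^ m ≤ C * (t - a) := by
    have := hb (t - a) ⟨hs0, hsδ⟩
    simpa [sub_add_cancel] using this
  have hm0 : (0:ℝ) < m := by exact_mod_cast (by omega : 0 < m)
  have h1 : |(t - a) * φ t| ≤ (C * (t - a)) ^ ((m:ℝ)⁻¹) := by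
    have h := Real.rpow_le_rpow (pow_nonneg (abs_nonneg _) m) key (inv_nonneg.mpr hm0.le)
    rwa [← Real.rpow_natCast, ← Real.rpow_mul (abs_nonneg _), mul_inv_cancel₀ hm0.ne',
      Real.rpow_one] at h
  rw [abs_mul, abs_of_pos hs0] at h1
  have h2 : |φ t| ≤ (C * (t - a)) ^ ((m:ℝ)⁻¹) / (t - a) := by
    rw [le_div_iff₀ hs0]; linarith [h1]
  calc |φ t| ≤ (C * (t - a)) ^ ((m:ℝ)⁻¹) / (t - a) := h2
    _ = C ^ ((m:ℝ)⁻¹) * (t - a) ^ ((m:ℝ)⁻¹ - 1) := by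
        rw [Real.mul_rpow hC hs0.le, Real.rpow_sub hs0, Real.rpow_one, mul_div_assoc]

/-! ## §3 Log-tameness: an INTEGRABLE `ℚ`-semialgebraic `φ` has `|φ t| ≤ C (t−a)^{1/N−1}` near `a` -/

/-- **Log-tameness of integrable semialgebraic functions of one variable.**  (Monotonicity theorem ⇒ near `a`
either `|φ|` is bounded, or `|φ| = ±φ` is antitone, whence `(t−a)|φ(t)| ≤ ∫_a^t |φ| → 0` and the growth dichotomy
gives the rational exponent.)  [van den Dries 1998 Ch. 3 (1.2) = tree `semialgebraic_monotonicity_holds`;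
HaPham2016 Lemma 1.7 = tree `exists_abs_pow_le_mul_of_tendsto`] -/
theorem exists_rpow_bound_of_integrableOn {φ : ℝ → ℝ} {a c : ℝ} (hac : a < c)
    (hφ : IsSemialgebraicFunOn ℚ {x : Fin 1 → ℝ | x 0 ∈ Ioo a c} (fun x => φ (x 0)))
    (hint : IntegrableOn φ (Ioo a c)) :
    ∃ (N : ℕ) (C δ : ℝ), 0 < N ∧ 0 < δ ∧
      ∀ t ∈ Ioo a (a + δ), |φ t| ≤ C * (t - a) ^ ((N : ℝ)⁻¹ - 1) := by
  obtain ⟨s, hs, hcells⟩ := semialgebraic_monotonicity_holds a c φ hac hφ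
  have hne : (insert c s).Nonempty := Finset.insert_nonempty c s
  set v := (insert c s).min' hne with hv_def
  have hv_mem : v ∈ insert c s := Finset.min'_mem _ _
  have hv : v = c ∨ v ∈ s := by
    rcases Finset.mem_insert.mp hv_mem with h | h
    · exact Or.inl h
    · exact Or.inr h
  have hav : a < v := by
    rcases hv with h | h
    · rw [h]; exact hac
    · exact (hs h).1
  have hvc : v ≤ c := Finset.min'_le _ _ (Finset.mem_insert_self c s)
  have hno : ∀ x ∈ s, x ∉ Ioo a v := fun x hx hx' =>
    (Finset.min'_le _ x (Finset.mem_insert_of_mem hx)).not_gt hx'.2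
  have hcell := hcells a v hav (Or.inl rfl) hv hno
  -- Case A: `|φ|` bounded near `a`
  have boundedCase : ∀ (B w : ℝ), a < w → (∀ t ∈ Ioo a w, |φ t| ≤ B) →
      ∃ (N : ℕ) (C δ : ℝ), 0 < N ∧ 0 < δ ∧
        ∀ t ∈ Ioo a (a + δ), |φ t| ≤ C * (t - a) ^ ((N : ℝ)⁻¹ - 1) := by
    intro B w haw hB
    refine ⟨1, B, w - a, one_pos, by linarith, fun t ht => ?_⟩
    have : (t - a) ^ (((1:ℕ):ℝ)⁻¹ - 1) = 1 := by norm_num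
    rw [this, mul_one]
    exact hB t ⟨ht.1, by linarith [ht.2]⟩
  -- Case B: `σφ ≥ 0` antitone on `(a, w)`
  have antitoneCase : ∀ (σ w : ℝ), (σ = 1 ∨ σ = -1) → a < w → w ≤ c →
      AntitoneOn (fun t => σ * φ t) (Ioo a w) → (∀ t ∈ Ioo a w, 0 ≤ σ * φ t) →
      ∃ (N : ℕ) (C δ : ℝ), 0 < N ∧ 0 < δ ∧
        ∀ t ∈ Ioo a (a + δ), |φ t| ≤ C * (t - a) ^ ((N : ℝ)⁻¹ - 1) := by
    intro σ w hσ haw hwc hanti hnn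
    have hint' : IntegrableOn (fun t => σ * φ t) (Ioo a w) :=
      (hint.mono_set (Ioo_subset_Ioo_right hwc)).const_mul σ
    have h0 := tendsto_mul_of_antitoneOn haw hanti hnn hint'
    have h0' : Tendsto (fun t => (t - a) * (σ * φ t)) (𝓝[>] a) (𝓝 0) := h0
    have hφσ : IsSemialgebraicFunOn ℚ {x : Fin 1 → ℝ | x 0 ∈ Ioo a c} (fun x => σ * φ (x 0)) := by
      rcases hσ with rfl | rfl
      · exact hφ.congr fun x _ => by simp
      · exact hφ.neg.congr fun x _ => by simp
    obtain ⟨N, C, δ, hN, hδ, hb⟩ := exists_rpow_bound_of_tendsto hac hφσ h0'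
    refine ⟨N, C, δ, hN, hδ, fun t ht => ?_⟩
    have h := hb t ht
    rcases hσ with rfl | rfl
    · simpa using h
    · simpa using h
  rcases hcell with ⟨K, hK⟩ | ⟨hmono, -⟩
  · exact boundedCase |K| v hav fun t ht => by rw [hK ht]
  · rcases hmono with hmono | hanti
    · by_cases hex : ∃ t₀ ∈ Ioo a v, φ t₀ ≤ 0
      · obtain ⟨t₀, ht₀, hφ0⟩ := hex
        refine antitoneCase (-1) t₀ (Or.inr rfl) ht₀.1 (ht₀.2.le.trans hvc) ?_ ?_
        · intro x hx y hy hxy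
          have h := hmono.monotoneOn ⟨hx.1, hx.2.trans ht₀.2⟩ ⟨hy.1, hy.2.trans ht₀.2⟩ hxy
          show -1 * φ y ≤ -1 * φ x
          linarith
        · intro t ht
          have h := hmono ⟨ht.1, ht.2.trans ht₀.2⟩ ht₀ ht.2
          show 0 ≤ -1 * φ t
          linarith
      · have hpos : ∀ t ∈ Ioo a v, 0 < φ t := fun t ht => by
          by_contra h
          exact hex ⟨t, ht, not_lt.mp h⟩
        have ht₁ : (a + v) / 2 ∈ Ioo a v := by constructor <;> linarith
        refine boundedCase (φ ((a + v) / 2)) ((a + v) / 2) ht₁.1 fun t ht => ?_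
        have ht' : t ∈ Ioo a v := ⟨ht.1, ht.2.trans ht₁.2⟩
        rw [abs_of_pos (hpos t ht')]
        exact (hmono ht' ht₁ ht.2).le
    · by_cases hex : ∃ t₀ ∈ Ioo a v, 0 ≤ φ t₀
      · obtain ⟨t₀, ht₀, hφ0⟩ := hex
        refine antitoneCase 1 t₀ (Or.inl rfl) ht₀.1 (ht₀.2.le.trans hvc) ?_ ?_
        · intro x hx y hy hxy
          have h := hanti.antitoneOn ⟨hx.1, hx.2.trans ht₀.2⟩ ⟨hy.1, hy.2.trans ht₀.2⟩ hxy
          show 1 * φ y ≤ 1 * φ x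
          linarith
        · intro t ht
          have h := hanti ⟨ht.1, ht.2.trans ht₀.2⟩ ht₀ ht.2
          show 0 ≤ 1 * φ t
          linarith
      · have hneg : ∀ t ∈ Ioo a v, φ t < 0 := fun t ht => by
          by_contra h
          exact hex ⟨t, ht, not_lt.mp h⟩
        have ht₁ : (a + v) / 2 ∈ Ioo a v := by constructor <;> linarith
        refine boundedCase (-φ ((a + v) / 2)) ((a + v) / 2) ht₁.1 fun t ht => ?_
        have ht' : t ∈ Ioo a v := ⟨ht.1, ht.2.trans ht₁.2⟩
        rw [abs_of_neg (hneg t ht')]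
        have h := hanti ht' ht₁ ht.2
        linarith

/-! ## §4 Consequence: `φ · g ∈ L¹` near `a` for `|g| ≤ A + B|log(t−a)|` -/

/-- `s^r · |log s|` is integrable on `(0, δ)` for `r > −1`, `δ ≤ 1` (`|log s| ≤ s^{−ε}/ε`). -/
theorem integrableOn_rpow_mul_abs_log {r δ : ℝ} (hr : -1 < r) (hδ : 0 < δ) (hδ1 : δ ≤ 1) :
    IntegrableOn (fun s : ℝ => s ^ r * |Real.log s|) (Ioo 0 δ) := by
  set ε := (r + 1) / 2 with hε_def
  have hε : 0 < ε := by rw [hε_def]; linarith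
  have hdom : IntegrableOn (fun s : ℝ => s ^ (r - ε) * ε⁻¹) (Ioo 0 δ) :=
    ((intervalIntegral.integrableOn_Ioo_rpow_iff hδ).mpr (by rw [hε_def]; linarith)).mul_const _
  refine Integrable.mono' hdom ?_ ?_
  · refine (ContinuousOn.mul ?_ ?_).aestronglyMeasurable measurableSet_Ioo
    · exact continuousOn_id.rpow_const fun x hx => Or.inl hx.1.ne'
    · exact (Real.continuousOn_log.mono fun x hx => hx.1.ne').abs
  · refine ae_restrict_of_forall_mem measurableSet_Ioo fun s hs => ?_
    have h1 := Real.abs_log_mul_self_rpow_lt s ε hs.1 (hs.2.le.trans hδ1) hε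
    rw [abs_mul, abs_of_nonneg (Real.rpow_nonneg hs.1.le ε)] at h1
    rw [Real.norm_eq_abs, abs_mul, abs_of_nonneg (Real.rpow_nonneg hs.1.le r), abs_abs]
    have h2 : |Real.log s| * s ^ ε ≤ ε⁻¹ := by rw [← one_div]; exact h1.le
    have hsε : s ^ ε ≠ 0 := (Real.rpow_pos_of_pos hs.1 ε).ne'
    calc s ^ r * |Real.log s| = s ^ (r - ε) * (|Real.log s| * s ^ ε) := by
          rw [Real.rpow_sub hs.1, div_mul_eq_mul_div, eq_div_iff hsε]
          ring
      _ ≤ s ^ (r - ε) * ε⁻¹ := mul_le_mul_of_nonneg_left h2 (Real.rpow_nonneg hs.1.le _)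

/-- **Cross-term integrability.** `|φ| ≤ C (t−a)^r` (`r > −1`) and `|g| ≤ A + B|log(t−a)|` on `(a, a+δ)` (`δ ≤ 1`),
both a.e.-strongly measurable there ⟹ `φ·g ∈ L¹(a, a+δ)`. -/
theorem integrableOn_mul_of_rpow_bound_of_log_bound {φ g : ℝ → ℝ} {a δ C A B r : ℝ} (hr : -1 < r)
    (hδ : 0 < δ) (hδ1 : δ ≤ 1)
    (hφm : AEStronglyMeasurable φ (volume.restrict (Ioo a (a + δ))))
    (hgm : AEStronglyMeasurable g (volume.restrict (Ioo a (a + δ))))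
    (hφ : ∀ t ∈ Ioo a (a + δ), |φ t| ≤ C * (t - a) ^ r)
    (hg : ∀ t ∈ Ioo a (a + δ), |g t| ≤ A + B * |Real.log (t - a)|) :
    IntegrableOn (fun t => φ t * g t) (Ioo a (a + δ)) := by
  -- the dominating function, first on `(0, δ)`, then translated
  have hF : IntegrableOn (fun s : ℝ => C * (A * s ^ r + B * (s ^ r * |Real.log s|))) (Ioo 0 δ) :=
    ((((intervalIntegral.integrableOn_Ioo_rpow_iff hδ).mpr hr).const_mul A).add
      ((integrableOn_rpow_mul_abs_log hr hδ hδ1).const_mul B)).const_mul C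
  have hI : IntervalIntegrable (fun s : ℝ => C * (A * s ^ r + B * (s ^ r * |Real.log s|))) volume 0 δ :=
    (intervalIntegrable_iff_integrableOn_Ioo_of_le hδ.le).mpr hF
  have hI' := hI.comp_sub_right a
  have hF' : IntegrableOn (fun t : ℝ => C * (A * (t - a) ^ r + B * ((t - a) ^ r * |Real.log (t - a)|)))
      (Ioo a (a + δ)) := by
    have h := (intervalIntegrable_iff_integrableOn_Ioo_of_le (by linarith : 0 + a ≤ δ + a)).mp hI'
    rw [zero_add, add_comm δ a] at h
    exact h
  refine Integrable.mono' hF' (hφm.mul hgm) ?_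
  refine ae_restrict_of_forall_mem measurableSet_Ioo fun t ht => ?_
  have h0 : 0 ≤ C * (t - a) ^ r := le_trans (abs_nonneg _) (hφ t ht)
  rw [Real.norm_eq_abs, abs_mul]
  calc |φ t| * |g t| ≤ C * (t - a) ^ r * (A + B * |Real.log (t - a)|) :=
        mul_le_mul (hφ t ht) (hg t ht) (abs_nonneg _) h0
    _ = C * (A * (t - a) ^ r + B * ((t - a) ^ r * |Real.log (t - a)|)) := by ring

/-! ## §5 `|log W| ≤ A + B|log(t−a)|` for positive semialgebraic `W`, and the packaged cross-term lemma -/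

/-- A positive `ℚ`-semialgebraic `W` on `(a, c)` satisfies `|log W(t)| ≤ A + B |log (t − a)|` near `a`
(two-sided power bounds `c₁ (t−a)^{m₁} ≤ W ≤ (t−a)^{−m₂}/c₂` from the growth dichotomy, HaPham2016 Lemma 1.7 /
tree `exists_mul_pow_le_abs_of_isSemialgebraic_graph`, applied to `W` and `1/W`). -/
theorem exists_abs_log_le {W : ℝ → ℝ} {a c : ℝ} (hac : a < c)
    (hW : IsSemialgebraicFunOn ℚ {x : Fin 1 → ℝ | x 0 ∈ Ioo a c} (fun x => W (x 0)))
    (hpos : ∀ t ∈ Ioo a c, 0 < W t) :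
    ∃ (A B δ : ℝ), 0 < δ ∧ δ ≤ 1 ∧ a + δ ≤ c ∧
      ∀ t ∈ Ioo a (a + δ), |Real.log (W t)| ≤ A + B * |Real.log (t - a)| := by
  have hca : 0 < c - a := sub_pos.mpr hac
  have hψ := isSemialgebraicFunOn_translate hW
  have hne1 : ∀ t ∈ Ioo 0 (c - a), W (t + a) ≠ 0 := fun t ht =>
    (hpos _ ⟨by linarith [ht.1], by linarith [ht.2]⟩).ne'
  have hne : ∀ x ∈ {x : Fin 1 → ℝ | x 0 ∈ Ioo 0 (c - a)}, W (x 0 + a) ≠ 0 := fun x hx => hne1 _ hx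
  have hG : IsSemialgebraic ℝ {w : Fin 2 → ℝ | w 0 ∈ Ioo 0 (c - a) ∧ w 1 = W (w 0 + a)} :=
    isSemialgebraic_graph_of_isSemialgebraicFunOn (f := fun s => W (s + a)) hψ
  have hGi : IsSemialgebraic ℝ {w : Fin 2 → ℝ | w 0 ∈ Ioo 0 (c - a) ∧ w 1 = (W (w 0 + a))⁻¹} :=
    isSemialgebraic_graph_of_isSemialgebraicFunOn (f := fun s => (W (s + a))⁻¹) (hψ.inv hne)
  have hne2 : ∀ t ∈ Ioo 0 (c - a), (W (t + a))⁻¹ ≠ 0 := fun t ht => inv_ne_zero (hne1 t ht)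
  obtain ⟨m₁, c₁, δ₁, hc₁, hδ₁, hlow₁⟩ := exists_mul_pow_le_abs_of_isSemialgebraic_graph hG hne1
  obtain ⟨m₂, c₂, δ₂, hc₂, hδ₂, hlow₂⟩ := exists_mul_pow_le_abs_of_isSemialgebraic_graph hGi hne2
  refine ⟨|Real.log c₁| + |Real.log c₂|, ((m₁ + m₂ : ℕ) : ℝ), min (min δ₁ δ₂) (min 1 (c - a)),
    lt_min (lt_min hδ₁ hδ₂) (lt_min one_pos hca), (min_le_right _ _).trans (min_le_left _ _), ?_,
    fun t ht => ?_⟩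
  · have := (min_le_right (min δ₁ δ₂) (min 1 (c - a))).trans (min_le_right 1 (c - a)); linarith
  obtain ⟨hat, htδ⟩ := ht
  have hm1 := min_le_left (min δ₁ δ₂) (min 1 (c - a))
  have hm2 := min_le_right (min δ₁ δ₂) (min 1 (c - a))
  have hs0 : 0 < t - a := by linarith
  have hsδ₁ : t - a < δ₁ := by have := hm1.trans (min_le_left δ₁ δ₂); linarith
  have hsδ₂ : t - a < δ₂ := by have := hm1.trans (min_le_right δ₁ δ₂); linarith
  have hs1 : t - a ≤ 1 := by have := hm2.trans (min_le_left 1 (c - a)); linarith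
  have hsc : t - a < c - a := by have := hm2.trans (min_le_right 1 (c - a)); linarith
  have hWpos : 0 < W t := hpos t ⟨hat, by linarith⟩
  have h1 := hlow₁ (t - a) ⟨hs0, hsc⟩ hs0 hsδ₁
  have h2 := hlow₂ (t - a) ⟨hs0, hsc⟩ hs0 hsδ₂
  simp only [sub_add_cancel] at h1 h2
  rw [abs_of_pos hWpos] at h1
  rw [abs_inv, abs_of_pos hWpos] at h2
  have hlog_s : Real.log (t - a) ≤ 0 := Real.log_nonpos hs0.le hs1
  have hL1 : Real.log c₁ + m₁ * Real.log (t - a) ≤ Real.log (W t) := by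
    have h := Real.log_le_log (by positivity) h1
    rwa [Real.log_mul hc₁.ne' (pow_pos hs0 _).ne', Real.log_pow] at h
  have hL2 : Real.log (W t) ≤ -(Real.log c₂ + m₂ * Real.log (t - a)) := by
    have h := Real.log_le_log (by positivity) h2
    rw [Real.log_mul hc₂.ne' (pow_pos hs0 _).ne', Real.log_pow, Real.log_inv] at h
    linarith
  have hB1 : ((m₁ + m₂ : ℕ) : ℝ) * Real.log (t - a) ≤ (m₁ : ℝ) * Real.log (t - a) :=
    mul_le_mul_of_nonpos_right (by push_cast; linarith) hlog_s
  have hB2 : ((m₁ + m₂ : ℕ) : ℝ) * Real.log (t - a) ≤ (m₂ : ℝ) * Real.log (t - a) :=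
    mul_le_mul_of_nonpos_right (by push_cast; linarith) hlog_s
  rw [abs_of_nonpos hlog_s, abs_le]
  simp only [mul_neg]
  constructor
  · linarith [neg_abs_le (Real.log c₁), abs_nonneg (Real.log c₂)]
  · linarith [neg_le_abs (Real.log c₂), abs_nonneg (Real.log c₁)]

/-- **Cross-term lemma (packaged).**  `φ` `ℚ`-semialgebraic and integrable on `(a, c)`, `W` `ℚ`-semialgebraic and
positive on `(a, c)` with `log W` a.e.-strongly measurable ⟹ `φ · log W ∈ L¹(a, a + δ)` for some `δ > 0`.
This is the LEFT-END case; the right end `t → c⁻` follows by the reflection `t ↦ −t`, and ends at `±∞` of an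
unbounded base cell by `t ↦ 1/t` (both preserve `ℚ`-semialgebraicity); interior compact pieces are handled by the
same lemma at each of the finitely many discontinuities / by boundedness. -/
theorem exists_integrableOn_mul_log {φ W : ℝ → ℝ} {a c : ℝ} (hac : a < c)
    (hφ : IsSemialgebraicFunOn ℚ {x : Fin 1 → ℝ | x 0 ∈ Ioo a c} (fun x => φ (x 0)))
    (hW : IsSemialgebraicFunOn ℚ {x : Fin 1 → ℝ | x 0 ∈ Ioo a c} (fun x => W (x 0)))
    (hpos : ∀ t ∈ Ioo a c, 0 < W t) (hint : IntegrableOn φ (Ioo a c))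
    (hWm : AEStronglyMeasurable (fun t => Real.log (W t)) (volume.restrict (Ioo a c))) :
    ∃ δ : ℝ, 0 < δ ∧ a + δ ≤ c ∧ IntegrableOn (fun t => φ t * Real.log (W t)) (Ioo a (a + δ)) := by
  obtain ⟨N, C, δ₁, hN, hδ₁, hb⟩ := exists_rpow_bound_of_integrableOn hac hφ hint
  obtain ⟨A, B, δ₂, hδ₂, hδ₂1, hδ₂c, hl⟩ := exists_abs_log_le hac hW hpos
  have hδ : 0 < min δ₁ δ₂ := lt_min hδ₁ hδ₂
  have hsub : Ioo a (a + min δ₁ δ₂) ⊆ Ioo a c := fun t ht =>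
    ⟨ht.1, by have := min_le_right δ₁ δ₂; linarith [ht.2]⟩
  refine ⟨min δ₁ δ₂, hδ, by have := min_le_right δ₁ δ₂; linarith, ?_⟩
  have hr : -1 < (N : ℝ)⁻¹ - 1 := by
    have : (0:ℝ) < (N : ℝ)⁻¹ := inv_pos.mpr (by exact_mod_cast hN)
    linarith
  refine integrableOn_mul_of_rpow_bound_of_log_bound (C := C) (A := A) (B := B) hr hδ
    ((min_le_right δ₁ δ₂).trans hδ₂1)
    ((hint.mono_set hsub).aestronglyMeasurable) (hWm.mono_set hsub) ?_ ?_
  · exact fun t ht => hb t ⟨ht.1, by have := min_le_left δ₁ δ₂; linarith [ht.2]⟩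
  · exact fun t ht => hl t ⟨ht.1, by have := min_le_right δ₁ δ₂; linarith [ht.2]⟩

end Summit.KontsevichZagierPeriods.RootDecompRelativeModAbsolute.Rung30571.RegularisedLogLayer.CylLogTame
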